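import Summits.FinalStateConjecture.FinalStateConjecture.Theorems.EIHFluxBalanceInertialRecessionFlatPackage

/-!
# Route EIHFluxBalance — `InertialRecession`: the radiation-zone package with a prescribed profile

Helper file for the crux `stmt-FinalStateConjecture-10166`
(`Summit.FinalStateConjecture.FinalStateConjecture.Theses.EIHFluxBalance.InertialRecession`).

Assembly of the flat-chart clauses of the sought `FinalStateDecomposition` for Schwarzschild holes
(`aᵢ = 0`) from (1) the crux's lab chart `Φ : U → M` and its `Cᵏ` deviation decay from the modulated
background, (2) velocity-level control of the painted motions (future-pointing 4-velocities with
smooth lab velocities of speed `≤ κ₀ < 1` and bounded derivatives eventually; smooth centres with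
bounded derivatives eventually), and (3) CESÀRO VELOCITIES `ξᵢ(t)/t → Vᵢ`, `‖Vᵢ‖ < 1`.
With the hole-following far domain `U₀ = {τ₁ < x⁰ ∧ ∀ i, R′(x⁰) < ‖x̃ − ξᵢ(x⁰)‖}` for a
PRESCRIBED continuous profile `R′ → ∞`, `R′(t)/t → 0`, `R′ ≥ 1 + Σ|rinᵢ|` (sibling of
`flat_radiationZone_package'`, where `R′ = √t + R₀` is hard-wired and `U₀` hidden), the theorem
`flat_radiationZone_package_of_profile'` delivers, with the underlying set of `U₀` exposed: `U₀ ≤ U`; the flat chart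
`Φ ∘ inclusion` is an open embedding of the late region `{x⁰ > τ₁}` and converges to `η` in `Cᵏ` on
whole slabs; and SUBLINEAR excision radii `ρᵢ` (`ρᵢ(t)/t → 0`) such that the complement of the
straight tubes `{r(boost(Vᵢ)⁻¹ x) ≤ ρᵢ(x⁰)}` in `{x⁰ > τ₁}` lies in `U₀` — i.e. the fields
`flatDomain`, `flatChart`, `isLateChart_flat` (open-embedding part), `tendsto_deviationCk_flat`,
`setOf_lt_excision_subset_flatDomain`, `tendsto_excision_div` for the motions `(boost Vᵢ, 0)`.
Inputs: `tendsto_deviationCk_flat_of_ansatz_schwarzschild'` (file `…FlatChartSchwarzschild`),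
`radius_poincareInv_le_of_near_centre'`, `tendsto_drift_div_of_cesaro` (file `…Tubes`),
`isOpenEmbedding_restrict_lateRegion_of_le'` (file `…LateChart`), `Lorentz.boost` (LorentzBoost).
-/

noncomputable section

open Literature.Geometry.Lorentzian Set Filter Function TopologicalSpace Topology
open scoped ContDiff Manifold ENNReal

namespace Summit.FinalStateConjecture.FinalStateConjecture.Theorems

-- operator-norm instance paths on form-valued multilinear maps are slow to unify
set_option synthInstance.maxHeartbeats 200000 in
/-- **The radiation-zone package for non-rotating holes, with a prescribed excision profile.**
Version of `flat_radiationZone_package'` in which the hole-following far domain is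
`U₀ = {τ₁ < x⁰ ∧ ∀ i, R′(x⁰) < ‖x̃ − ξᵢ(x⁰)‖}` for ANY continuous profile `R′ → ∞` with
`R′(t)/t → 0` and `R′ ≥ 1 + Σᵢ |rinᵢ|` (so that the consumer can keep `R′` below the honest-zone
radii of the hole charts), and the underlying set of `U₀` is exposed: `U₀ ≤ U`; the flat chart
`Φ ∘ inclusion` is an open embedding of `{x⁰ > τ₁}` (`τ₁ = max τ₀ 0 + 1`) converging to `η` in `Cᵏ`;
sublinear excision radii `ρᵢ` with `{τ₁ < x⁰ ∧ ∀ i, ρᵢ(x⁰) < r(boost(Vᵢ)⁻¹ x)} ⊆ U₀`. [folklore] -/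
theorem flat_radiationZone_package_of_profile' (𝓢 : Spacetime 4) {N : ℕ} (M rin : Fin N → ℝ)
    (Λ : Fin N → ℝ → lorentzGroup) (ξ v : Fin N → ℝ → E3) (τ₀ : ℝ) (U : Opens E4)
    (Φ : U → 𝓢.carrier) (hΦ : ContMDiff 𝓘(ℝ, E4) (𝓡 4) ∞ Φ)
    (hU : {x : E4 | τ₀ < x 0 ∧ ∀ i, rin i < Kerr.radius 0 (poincareInv (Λ i (x 0))
      (E4.ofTimeSpace (x 0) (ξ i (x 0))) x)} ⊆ (U : Set E4))
    (hemb : IsOpenEmbedding (((⟨U, fun x ↦ Minkowski.bilin +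
      ∑ i, (boostedKerrBilin (Λ i (x 0)) (E4.ofTimeSpace (x 0) (ξ i (x 0))) (M i) 0 x -
        Minkowski.bilin), fun x ↦ x 0, E4.spatialNorm⟩ : ModelBackground).lateRegion τ₀).restrict Φ))
    {k : ℕ}
    (hdev : Tendsto (fun t ↦ 𝓢.deviationCk ⟨U, fun x ↦ Minkowski.bilin +
      ∑ i, (boostedKerrBilin (Λ i (x 0)) (E4.ofTimeSpace (x 0) (ξ i (x 0))) (M i) 0 x -
        Minkowski.bilin), fun x ↦ x 0, E4.spatialNorm⟩ Φ k t) atTop (𝓝 0))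
    (hfut : ∀ i t, 0 < (((Λ i t : E4 ≃L[ℝ] E4) (E4.basisVector 0)) 0))
    (hvΛ : ∀ i t, E4.spatial ((Λ i t : E4 ≃L[ℝ] E4) (E4.basisVector 0)) =
      (((Λ i t : E4 ≃L[ℝ] E4) (E4.basisVector 0)) 0) • v i t)
    {κ₀ : ℝ} (hκ₀ : κ₀ < 1) (hvs : ∀ i t, ‖v i t‖ ≤ κ₀)
    (hv : ∀ i, ContDiff ℝ ∞ (v i)) (hξ : ∀ i, ContDiff ℝ ∞ (ξ i)) {Γ T₀ : ℝ}
    (hvb : ∀ i t, T₀ ≤ t → ∀ j, 1 ≤ j → j ≤ k → ‖iteratedDeriv j (v i) t‖ ≤ Γ)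
    (hξb : ∀ i t, T₀ ≤ t → ∀ j, 1 ≤ j → j ≤ k → ‖iteratedDeriv j (ξ i) t‖ ≤ Γ)
    (V : Fin N → E3) (hV1 : ∀ i, ‖V i‖ < 1)
    (hV : ∀ i, Tendsto (fun t : ℝ ↦ t⁻¹ • ξ i t) atTop (𝓝 (V i))) {R' : ℝ → ℝ}
    (hR'c : Continuous R') (hR'R₀ : ∀ t, 1 + ∑ i, |rin i| ≤ R' t) (hR'top : Tendsto R' atTop atTop)
    (hR'div : Tendsto (fun t ↦ R' t / t) atTop (𝓝 0)) :
    ∃ (U₀ : Opens E4) (hU₀ : U₀ ≤ U) (ρ : Fin N → ℝ → ℝ),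
      (U₀ : Set E4) = {x : E4 | max τ₀ 0 + 1 < x 0 ∧ ∀ i, R' (x 0) < ‖E4.spatial x - ξ i (x 0)‖} ∧
      (∀ i, Tendsto (fun t ↦ ρ i t / t) atTop (𝓝 0)) ∧
      {x : E4 | max τ₀ 0 + 1 < x 0 ∧ ∀ i, ρ i (x 0) <
        Kerr.radius 0 (poincareInv (Lorentz.boost (V i) (hV1 i)) 0 x)} ⊆ (U₀ : Set E4) ∧
      Tendsto (fun t ↦ 𝓢.deviationCk (Minkowski.backgroundOn U₀) (Φ ∘ Opens.inclusion hU₀) k t)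
        atTop (𝓝 0) ∧
      IsOpenEmbedding (((Minkowski.backgroundOn U₀).lateRegion (max τ₀ 0 + 1)).restrict
        (Φ ∘ Opens.inclusion hU₀)) := by
  -- the far-distance function and the domain
  set R₀ : ℝ := 1 + ∑ i, |rin i| with hR₀
  have hR₀i : ∀ i, rin i < R₀ := fun i ↦ by
    have h1 : |rin i| ≤ ∑ j, |rin j| :=
      Finset.single_le_sum (f := fun j ↦ |rin j|) (fun _ _ ↦ abs_nonneg _) (Finset.mem_univ i)
    linarith [le_abs_self (rin i)]
  have hR'R₀' : ∀ t, R₀ ≤ R' t := fun t ↦ by rw [hR₀]; exact hR'R₀ t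
  -- the start time and the hole-following far domain
  set τ₁ : ℝ := max τ₀ 0 + 1 with hτ₁
  have hτ₀₁ : τ₀ ≤ τ₁ := (le_max_left τ₀ 0).trans (le_add_of_nonneg_right zero_le_one)
  have hc0 : Continuous fun y : E4 ↦ y 0 := PiLp.continuous_apply 2 _ 0
  have hopen : IsOpen {x : E4 | τ₁ < x 0 ∧ ∀ i, R' (x 0) < ‖E4.spatial x - ξ i (x 0)‖} := by
    have h1 : IsOpen {x : E4 | τ₁ < x 0} := isOpen_lt continuous_const hc0
    have h2 : IsOpen (⋂ i, {x : E4 | R' (x 0) < ‖E4.spatial x - ξ i (x 0)‖}) :=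
      isOpen_iInter_of_finite fun i ↦ isOpen_lt (hR'c.comp hc0)
        (continuous_norm.comp (E4.spatial.continuous.sub ((hξ i).continuous.comp hc0)))
    have h3 : {x : E4 | τ₁ < x 0 ∧ ∀ i, R' (x 0) < ‖E4.spatial x - ξ i (x 0)‖} =
        {x : E4 | τ₁ < x 0} ∩ ⋂ i, {x : E4 | R' (x 0) < ‖E4.spatial x - ξ i (x 0)‖} := by
      ext x
      simp
    rw [h3]
    exact h1.inter h2
  let U₀ : Opens E4 := ⟨{x : E4 | τ₁ < x 0 ∧ ∀ i, R' (x 0) < ‖E4.spatial x - ξ i (x 0)‖}, hopen⟩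
  -- `U₀ ≤ U`
  have hU₀ : U₀ ≤ U := by
    intro x hx
    have hx' : τ₁ < x 0 ∧ ∀ i, R' (x 0) < ‖E4.spatial x - ξ i (x 0)‖ := hx
    refine hU ⟨lt_of_le_of_lt hτ₀₁ hx'.1, fun i ↦ ?_⟩
    have h1 := sq_sub_sq_le_radius_poincareInv_sq (Λ i (x 0)) 0 (x 0) (ξ i (x 0)) (x := x) rfl
    have h2 : ‖E4.spatial x - ξ i (x 0)‖ ≤
        Kerr.radius 0 (poincareInv (Λ i (x 0)) (E4.ofTimeSpace (x 0) (ξ i (x 0))) x) := by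
      refine (sq_le_sq₀ (norm_nonneg _) (Kerr.radius_nonneg _ _)).mp ?_
      nlinarith
    exact ((hR₀i i).trans_le (hR'R₀' (x 0))).trans (lt_of_lt_of_le (hx'.2 i) h2)
  -- the excision radii
  set ρ : Fin N → ℝ → ℝ := fun i t ↦
    (1 + 3 * |((Lorentz.boost (V i) (hV1 i) : E4 ≃L[ℝ] E4) (E4.basisVector 0)) 0|) *
      (R' t + ‖ξ i t - t • V i‖) + 1 with hρ
  refine ⟨U₀, hU₀, ρ, rfl, fun i ↦ ?_, ?_, ?_, ?_⟩
  · -- sublinearity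
    have hdrift : Tendsto (fun t ↦ ‖ξ i t - t • V i‖ / t) atTop (𝓝 0) := by
      have h := tendsto_drift_div_of_cesaro (hV i) 0 0
      refine h.congr fun t ↦ ?_
      rw [zero_add, sub_zero]
    have h1 := tendsto_excisionRadius_div
      (1 + 3 * |((Lorentz.boost (V i) (hV1 i) : E4 ≃L[ℝ] E4) (E4.basisVector 0)) 0|) hR'div hdrift
    have h2 : Tendsto (fun t : ℝ ↦ (1 : ℝ) / t) atTop (𝓝 0) := tendsto_const_nhds.div_atTop tendsto_id
    have h3 := h1.add h2
    rw [add_zero] at h3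
    refine h3.congr fun t ↦ ?_
    change _ = ((1 + 3 * |((Lorentz.boost (V i) (hV1 i) : E4 ≃L[ℝ] E4) (E4.basisVector 0)) 0|) *
      (R' t + ‖ξ i t - t • V i‖) + 1) / t
    rw [add_div]
  · -- containment of the complement of the straight tubes
    rintro x ⟨hx1, hx2⟩
    refine ⟨hx1, fun i ↦ ?_⟩
    by_contra hle
    have hle' : ‖E4.spatial x - ξ i (x 0)‖ ≤ R' (x 0) := not_lt.mp hle
    have h := radius_poincareInv_le_of_near_centre' (Lorentz.boost (V i) (hV1 i)) 0 0 (ξ i) R' hle'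
    rw [boostVelocity_boost (hV1 i), map_zero, zero_add] at h
    have h0 : (0 : E4) 0 = 0 := rfl
    rw [h0, sub_zero] at h
    have h2 := hx2 i
    change (1 + 3 * |((Lorentz.boost (V i) (hV1 i) : E4 ≃L[ℝ] E4) (E4.basisVector 0)) 0|) *
      (R' (x 0) + ‖ξ i (x 0) - x 0 • V i‖) + 1 < _ at h2
    linarith
  · -- flat convergence
    exact tendsto_deviationCk_flat_of_ansatz_schwarzschild' 𝓢 M Λ ξ v U Φ hΦ hdev hfut hvΛ hκ₀ hvs
      hv hξ hvb hξb hR'top hU₀ fun z hz i ↦ hz.2 i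
  · -- open embedding of the later, smaller late region
    exact isOpenEmbedding_restrict_lateRegion_of_le' (M := 𝓢.carrier) ⟨U, fun x ↦ Minkowski.bilin +
      ∑ i, (boostedKerrBilin (Λ i (x 0)) (E4.ofTimeSpace (x 0) (ξ i (x 0))) (M i) 0 x -
        Minkowski.bilin), fun x ↦ x 0, E4.spatialNorm⟩ (fun _ ↦ rfl) hemb hU₀ hτ₀₁


-- operator-norm instance paths on form-valued multilinear maps are slow to unify
set_option synthInstance.maxHeartbeats 200000 in
/-- Registered sub-goal form (stub `flat_radiationZone_package_of_profile` of the crux item) of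
`flat_radiationZone_package_of_profile'`. [folklore] -/
theorem flat_radiationZone_package_of_profile : open Literature.Geometry.Lorentzian Topology in ∀ (𝓢 : Spacetime 4) {N : ℕ} (M rin : Fin N → ℝ) (Λ : Fin N → ℝ → lorentzGroup) (ξ v : Fin N → ℝ → E3) (τ₀ : ℝ) (U : Opens E4) (Φ : U → 𝓢.carrier), ContMDiff 𝓘(ℝ, E4) (𝓡 4) ((⊤ : ℕ∞) : WithTop ℕ∞) Φ → {x : E4 | τ₀ < x 0 ∧ ∀ i, rin i < Kerr.radius 0 (poincareInv (Λ i (x 0)) (E4.ofTimeSpace (x 0) (ξ i (x 0))) x)} ⊆ (U : Set E4) → IsOpenEmbedding (((⟨U, fun x ↦ Minkowski.bilin + ∑ i, (boostedKerrBilin (Λ i (x 0)) (E4.ofTimeSpace (x 0) (ξ i (x 0))) (M i) 0 x - Minkowski.bilin), fun x ↦ x 0, E4.spatialNorm⟩ : ModelBackground).lateRegion τ₀).restrict Φ) → ∀ {k : ℕ}, Tendsto (fun t ↦ 𝓢.deviationCk ⟨U, fun x ↦ Minkowski.bilin + ∑ i, (boostedKerrBilin (Λ i (x 0)) (E4.ofTimeSpace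 (x 0) (ξ i (x 0))) (M i) 0 x - Minkowski.bilin), fun x ↦ x 0, E4.spatialNorm⟩ Φ k t) atTop (𝓝 0) → (∀ i t, 0 < (((Λ i t : E4 ≃L[ℝ] E4) (E4.basisVector 0)) 0)) → (∀ i t, E4.spatial ((Λ i t : E4 ≃L[ℝ] E4) (E4.basisVector 0)) = (((Λ i t : E4 ≃L[ℝ] E4) (E4.basisVector 0)) 0) • v i t) → ∀ {κ₀ : ℝ}, κ₀ < 1 → (∀ i t, ‖v i t‖ ≤ κ₀) → (∀ i, ContDiff ℝ ((⊤ : ℕ∞) : WithTop ℕ∞) (v i)) → (∀ i, ContDiff ℝ ((⊤ : ℕ∞) : WithTop ℕ∞) (ξ i)) → ∀ {Γ T₀ : ℝ}, (∀ i t, T₀ ≤ t → ∀ j, 1 ≤ j → j ≤ k → ‖iteratedDeriv j (v i) t‖ ≤ Γ) → (∀ i t, T₀ ≤ t → ∀ j, 1 ≤ j → j ≤ k → ‖iteratedDeriv j (ξ i) t‖ ≤ Γ) → ∀ (V : Fin N → E3) (hV1 : ∀ i, ‖V i‖ < 1), (∀ i, Tendsto (fun t : ℝ ↦ t⁻¹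 • ξ i t) atTop (𝓝 (V i))) → ∀ {R' : ℝ → ℝ}, Continuous R' → (∀ t, 1 + ∑ i, |rin i| ≤ R' t) → Tendsto R' atTop atTop → Tendsto (fun t ↦ R' t / t) atTop (𝓝 0) → ∃ (U₀ : Opens E4) (hU₀ : U₀ ≤ U) (ρ : Fin N → ℝ → ℝ), (U₀ : Set E4) = {x : E4 | max τ₀ 0 + 1 < x 0 ∧ ∀ i, R' (x 0) < ‖E4.spatial x - ξ i (x 0)‖} ∧ (∀ i, Tendsto (fun t ↦ ρ i t / t) atTop (𝓝 0)) ∧ {x : E4 | max τ₀ 0 + 1 < x 0 ∧ ∀ i, ρ i (x 0) < Kerr.radius 0 (poincareInv (Lorentz.boost (V i) (hV1 i)) 0 x)} ⊆ (U₀ : Set E4) ∧ Tendsto (fun t ↦ 𝓢.deviationCk (Minkowski.backgroundOn U₀) (Φ ∘ Opens.inclusion hU₀) k t) atTop (𝓝 0) ∧ IsOpenEmbedding (((Minkowski.backgroundOn U₀).lateRegion (max τ₀ 0 + 1)).restrict (Φ ∘ Opens.inclusion hU₀)) :=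
  fun 𝓢 _ M rin Λ ξ v τ₀ U Φ hΦ hU hemb _ hdev hfut hvΛ _ hκ₀ hvs hv hξ _ _ hvb hξb V hV1 hV _ hR'c hR'R₀ hR'top hR'div ↦
    flat_radiationZone_package_of_profile' 𝓢 M rin Λ ξ v τ₀ U Φ hΦ hU hemb hdev hfut hvΛ hκ₀ hvs hv hξ hvb hξb
      V hV1 hV hR'c hR'R₀ hR'top hR'div

end Summit.FinalStateConjecture.FinalStateConjecture.Theorems

end
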